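import Summits.BirchSwinnertonDyer.BirchSwinnertonDyer.Theses.PAdicOrderV2
import Literature.NumberTheory.EllipticCurves.LeadingTerm
import Literature.NumberTheory.EllipticCurves.LeadingTermProofs

/-!
# Crux `PAdicOrderThesisR2` (stmt-BirchSwinnertonDyer-0487), line `Sketch` — stub `stub_LB_rank1`

The stub `stub_LB_rank1` of the Kato-sandwich skeleton (`Cruxes/PAdicOrderThesisR2/Lines/Sketch`)
is the classical lower bound in analytic rank one,

  `∀ W/ℚ elliptic, globally minimal, ord_{s=1} L(W, s) = 1 → 1 ≤ rank_ℤ W(ℚ)`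

(Gross–Zagier 1986, Thm. I.6.3 + Kolyvagin 1990: the Heegner point is non-torsion). Neither
Gross–Zagier nor Kolyvagin is proved in the tree, so the stub cannot be closed unconditionally.
This file records, sorry-free, the two honest CONDITIONAL renderings, each a one-line consequence
of an existing named fact of the Literature library:

* `stub_LB_rank1_of_rank_eq_analyticRank` — from bsd.S17
  `Literature.NumberTheory.EllipticCurves.rank_eq_analyticRank_of_analyticRank_le_one`
  (Gross–Zagier–Kolyvagin as printed in Darmon 2004, Thm. 3.22: `ord ≤ 1 ⇒ rank = ord ∧ #Ш < ∞`;
  itself reduced in `HeegnerPointReflectionHolds` to modularity, Waldspurger, Murty–Murty,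
  `gross_zagier`, `exists_isHeegnerPoint`, `kolyvagin`);
* `stub_LB_rank1_of_gross_zagier_rank_one_rat` — from the strictly weaker named fact
  `WeierstrassCurve.gross_zagier_rank_one_rat` (rank-one Gross–Zagier over `ℚ`:
  `ord = 1 ⇒ ∃ P ∈ E(ℚ), c > 0, L'(E,1) = c · ĥ(P)`; no Kolyvagin), through the proved tree
  theorem `one_le_mordellWeilRank_of_analyticRank_eq_one` (`LeadingTermProofs`:
  `L'(E,1) ≠ 0 ⇒ ĥ(P) ≠ 0 ⇒ P` non-torsion ⇒ rank `≥ 1` by Mordell–Weil).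

The hypothesis `[W.IsGloballyMinimal]` of the stub is not used by either proof (rank and analytic
rank are model-independent); it is kept so that the conclusions are the stub's signature verbatim.
Deliberately NOT here: any attempt at Gross–Zagier or Kolyvagin themselves.
-/

-- D-0017: single-problem summit, so `Summit.BirchSwinnertonDyer.BirchSwinnertonDyer.…` repeats a
-- namespace BY DESIGN (the `Summits` lib sets this option in `lakefile.toml`; repeated for standalone checks).
set_option linter.dupNamespace false

namespace Summit.BirchSwinnertonDyer.BirchSwinnertonDyer.Cruxes.PAdicOrderThesisR2.KatoSandwich

open Literature.NumberTheory.EllipticCurves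

/-- **Stub `stub_LB_rank1`, conditional on Gross–Zagier–Kolyvagin (bsd.S17).** If the named fact
`rank_eq_analyticRank_of_analyticRank_le_one` holds — for every elliptic `E/ℚ` with
`ord_{s=1} L(E, s) ≤ 1`, `rank_ℤ E(ℚ) = ord_{s=1} L(E, s)` and `Ш(E/ℚ)` is finite (Gross–Zagier
1986 Thm. I.6.3, Kolyvagin 1990, stated as Darmon 2004, Thm. 3.22) — then every globally minimal
elliptic `W/ℚ` of analytic rank `1` has `1 ≤ rank_ℤ W(ℚ)` (indeed `rank = 1`). Proof: apply the
fact at `W` with `ord = 1 ≤ 1` and rewrite. [cite: Darmon2004, Thm. 3.22] -/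
theorem stub_LB_rank1_of_rank_eq_analyticRank :
    rank_eq_analyticRank_of_analyticRank_le_one →
      ∀ (W : WeierstrassCurve ℚ) [W.IsElliptic] [W.IsGloballyMinimal],
        W.analyticRank = 1 → 1 ≤ W.mordellWeilRank := by
  intro h W _ _ h1
  have hrk : W.mordellWeilRank = W.analyticRank := (h W (le_of_eq h1)).1
  rw [hrk, h1]

/-- **Stub `stub_LB_rank1`, conditional on rank-one Gross–Zagier over `ℚ` only.** If the named
fact `WeierstrassCurve.gross_zagier_rank_one_rat` holds — `ord_{s=1} L(E, s) = 1 ⇒` there are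
`P ∈ E(ℚ)` and `c > 0` with `L'(E, 1) = c · ĥ(P)` (Gross–Zagier 1986, Thm. I.6.3 with §V.2 and a
non-vanishing quadratic twist) — then every globally minimal elliptic `W/ℚ` of analytic rank `1`
has `1 ≤ rank_ℤ W(ℚ)`. This is the proved tree theorem
`one_le_mordellWeilRank_of_analyticRank_eq_one` (`LeadingTermProofs`: `L'(E, 1) ≠ 0`, so
`ĥ(P) ≠ 0`, so `P` has infinite order, so `rank ≥ 1` by the Mordell–Weil theorem); Kolyvagin's
theorem is not needed for this inequality. [cite: GrossZagierInvent1986, Thm. I.6.3 and §V.2] -/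
theorem stub_LB_rank1_of_gross_zagier_rank_one_rat :
    WeierstrassCurve.gross_zagier_rank_one_rat →
      ∀ (W : WeierstrassCurve ℚ) [W.IsElliptic] [W.IsGloballyMinimal],
        W.analyticRank = 1 → 1 ≤ W.mordellWeilRank :=
  fun h W _ _ h1 ↦ one_le_mordellWeilRank_of_analyticRank_eq_one h W h1

end Summit.BirchSwinnertonDyer.BirchSwinnertonDyer.Cruxes.PAdicOrderThesisR2.KatoSandwich
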